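import Summits.QuantumFields.BalabanUV.T4Continuum.Support.BlockAverageQuadRemainder
import Summits.QuantumFields.BalabanUV.T4Continuum.Support.AveragingDeficitMultiLevelPrep
import Summits.QuantumFields.BalabanUV.T4Continuum.Support.NE7SecondOrderChainRuleVec
import Literature.MathematicalPhysics.QuantumFieldTheory.Balaban1983to89.T4TermwiseTorus
import Literature.MathematicalPhysics.QuantumFieldTheory.Balaban1983to89.B13Contraction113
import Mathlib.Analysis.Complex.Liouville
import HarnessLib

/-!
# NE7OneStepConstraintCurvature — THE ONE-STEP KINEMATIC LETTER FOR THE CURVATURE OF THE CONSTRAINT: AT A CURVED SMALL-FIELD `U(n)` BACKGROUND `W` THE SECOND DERIVATIVE OF THE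
# CHART COORDINATES OF BAŁABAN'S ONE-STEP AVERAGE (42), `D²coord_W(0)[ψ, ψ]`, IS BOUNDED BOND BY BOND BY THE LOCAL `ℓ²` MASS OF THE DIRECTION, AND ITS `ℓ¹` NORM OVER ONE COARSE
# PERIOD BY THE `ℓ²` MASS OF THE DIRECTION OVER ONE FINE PERIOD: `Σ_{c} ‖D²coord_W(0)[ψ,ψ](c)‖ ≤ (4∕rho0²)·d(2·nbRad+1)^d · Σ_{b} ‖ψ̃_b‖²` — BILINEAR-LOCAL, VOLUME-FREE
# (ROAD-G116 §6 (G3), kinematic side; the input of ✓ `NE7ConstraintSecondDerivativeRecursion` at every level of the tower)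

Cell `pub-balaban`, rung (B)+1 sub-cell t4, lineage `b2b-balaban-t4-ne7b-p1` (row NE7b OWNER + CRUX PROVER; junction service for row NE7, ruling R-OWNER-149-1 (2)), generation 161.
Index `t4/b2b-balaban-t4-ne7b-p1/g161/INDEX.md`; memo `g161/records/SCOPING-G3.md`.
WHY.  The multiplier term `Dm(0)[D²𝒢(0)[X,X]]` of the bordered Hessian (✓ p828683) is paired with a multiplier of `ℓ¹`-density `O(ε)` (✓ `NE7MultiplierOfRightInverse`); a bound
`j`-uniform for the LOWER estimate over a gauge slice needs `D²𝒢` in a BILINEAR-LOCAL currency (a sup-norm letter loses `L^{4(j+1)}` against the `H¹` energy in `d = 4`); by the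
tower recursion (✓ `NE7ConstraintSecondDerivativeRecursion.fderiv_fderiv_levelQ_chart_succ`) this reduces to ONE averaging step at each (curved, small-field) level background —
THIS FILE.  The analysis is row NE3 leaf-10's (✓ `BlockAverageVaryHolo` ∕ `BlockAverageVaryDisc`: the relative chart coordinate `σ ↦ log(W̄(c)⁻¹·\overline{W e^{σX}}(c))` is
HOLOMORPHIC and bounded by `1∕2` on the disc `‖σ‖ < rho0 d L ∕ s`, `s` a sup of `‖X‖` on the contour neighbourhood of `c`); where leaf-10 read off the quadratic Taylor REMAINDER
(✓ `BlockAverageQuadRemainder`), we read off the SECOND DERIVATIVE by Cauchy's estimate (Mathlib `Complex.norm_iteratedDeriv_le_of_forall_mem_sphere_norm_le`), and `sup² ≤ ℓ²` on the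
neighbourhood makes the bound bilinear-local.  (Cauchy's estimate is Mathlib's, inlined; the real restriction is ✓ `B13Contraction113.hasDerivAt_comp_ofReal`; the «margin» letters of
✓ `NE3LinearisingPath` §1 are not imported because that module's import closure (`NE3Linearising`) does not build on the farm at the time of filing.)
WHAT ([folklore]; 0 def, 0 sorry; every `d`, every `U(n)`, `L ≥ 1`; `W` unitary with `SmallField W a`, `512(d+1)(d+4)L²a ≤ 1`):
* §1 **`norm_deriv_deriv_relAvg_le`** — `‖(d²∕dσ²)|₀ log(W̄(c)⁻¹·\overline{W e^{σX}}(c))‖ ≤ 4s²∕rho0²` whenever `‖X(b)‖ ≤ s` (`s > 0`) on the bonds within `l¹`-distance `nbRad d L`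
  of `c₋` (Cauchy on the closed disc of radius `rho0∕(2s)`).
* §0 `deriv_deriv_ofReal_eq` (real and complex second derivatives of a holomorphic map agree at a real point); §2 the identifications: `coord_smul_apply_eq_relAvg` (for real `t`, `coord L M W (t•ψ) y κ = relAvg L W ψ̃ (L·y) κ t`, `ψ̃ = chartDir id ψ`); `apply_fderiv_fderiv_eq_deriv_deriv`
  (for a `C²` map `F` and a continuous linear `π`: `π(D²F(0)[u,u]) = (d²∕dt²)|₀ π(F(t u))`, pure calculus); hence **`fderiv_fderiv_coord_apply_eq`**: `(D²coord_W(0)[ψ,ψ]) y κ = (d²∕dσ²)|₀ relAvg L W ψ̃ (L·y) κ`.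
* §3 **`norm_fderiv_fderiv_coord_apply_le`** — `‖(D²coord_W(0)[ψ,ψ]) y κ‖ ≤ (4∕rho0 d L²)·dirSq ψ̃ (box (nbRad d L) (L·y))` (local `ℓ²` mass on the `ℓ^∞` box of radius `nbRad` about `c₋`).
* §4 **`sum_norm_fderiv_fderiv_coord_le`** — `Σ_{y} Σ_κ ‖(D²coord_W(0)[ψ,ψ]) y κ‖ ≤ (4∕rho0 d L²)·d·(2·nbRad d L+1)^d · dirSq ψ̃ (periodBox (L·M))` (torus multiplicity of the contour
  neighbourhoods, ✓ `AveragingDeficitPeriodicCounting.sum_periodBox_box_le`); `…_of_levelSmall` — the same under row NE3-R2's multi-level class hypotheses (`LevelSmall d L j x`), the form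
  ✓ `NE7ConstraintSecondDerivativeRecursion` consumes at each level.
HONEST FRAMING (page 1): kinematics of ONE block-averaging step on ONE lattice over landed kernel theorems (no two lattice spacings compared here; the `j`-uniform multiplier bound is the
assembly file); constants `rho0 d L = 1∕(256(d+1)L)`, `nbRad d L = 2dL + 2L` BY NAME, not optimised; OUR objects (B7 (42) `bavg`, the exponential chart `coord`); nothing of Bałaban's
asserted ([Balaban1985Averaging] Prop. 3 (122)–(123), Prop. 4 (134)–(136) context only); NOT NE7 as a spine node, NOT NE3; row NE7b NOT PRINTED ∕ NOT PROVED; spine 0∕9; finite T⁴ rung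
(B)+1 — NOT infinite volume, NOT mass gap, NOT BetaPertH, NOT Clay.
-/

set_option autoImplicit false

open scoped BigOperators Matrix Matrix.Norms.L2Operator Topology
open NormedSpace Finset Set Filter Metric

namespace Summit.QuantumFields.BalabanUV.T4Continuum.NE7OneStepConstraintCurvature

open Literature.MathematicalPhysics.QuantumFieldTheory.Balaban1983to89
open B7Prop1Explicit B7Prop2Explicit MatrixLog UnitaryModel
open T4AveragingDeficitWall (IsUnitaryCfg SmallField vary dirSq box norm_Wcx_sub_one_lt_one_of_smallField)
open T4AveragingDeficitWallBoundary (periodBox)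
open AveragingDeficitPeriodicCounting (IsPeriodicDir sum_periodBox_box_le natCast_mul_period)
open AveragingDeficitTorusChart (TDir chart chartDir chart_smul chartDir_add_smul)
open AveragingDeficitChartCalculus (cavg relLog coord coord_zero contDiffAt_coord)
open AveragingDeficitTwoLevelPrep (smallness_of_twoLevelSmall)
open AveragingDeficitMultiLevelPrep (LevelSmall)
open AveragingDeficitFermat (small512_of_liftSmall)
open BlockAverageVaryHolo (cvary relAvg nbRad)
open BlockAverageVaryDisc (rho0 rho0_pos differentiableOn_relAvg norm_relAvg_le_of_mem_ball)
open BlockAverageQuadRemainder (relAvg_ofReal norm_le_sqrt_dirSq)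
open NE7SecondOrderChainRuleVec (fderiv_fderiv_comp_vec fderiv_fderiv_comp_clm_vec)

noncomputable section

variable {d : ℕ} {n : Type*} [Fintype n] [DecidableEq n]

/-! ## §0 Real and complex second derivatives of a holomorphic map agree -/

/-- **Real and complex second derivatives agree**: for `h : ℂ → E` (complete `E`) complex-differentiable on an open `U ∋ 0`, the second derivative at `0` of the real restriction
`t ↦ h t` is `deriv (deriv h) 0` (✓ `B13Contraction113.hasDerivAt_comp_ofReal` at the map and at its derivative, which is again holomorphic on `U`; cf. ✓ `NE3LinearisingPath` §1,
whose import closure does not build on the farm at the time of filing). [folklore] -/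
theorem deriv_deriv_ofReal_eq {E : Type*} [NormedAddCommGroup E] [NormedSpace ℂ E] [CompleteSpace E] {h : ℂ → E} {U : Set ℂ} (hU : IsOpen U)
    (hd : DifferentiableOn ℂ h U) (h0 : (0 : ℂ) ∈ U) :
    deriv (deriv (fun s : ℝ => h (s : ℂ))) 0 = deriv (deriv h) 0 := by
  have hd' : DifferentiableOn ℂ (deriv h) U := ((hd.analyticOnNhd hU).deriv_of_isOpen hU).differentiableOn
  -- near `0` the real derivative is the complex one read at real points
  have hpre : IsOpen {s : ℝ | (s : ℂ) ∈ U} := hU.preimage Complex.continuous_ofReal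
  have hmem : (0 : ℝ) ∈ {s : ℝ | (s : ℂ) ∈ U} := by simpa using h0
  have hev : (deriv (fun s : ℝ => h (s : ℂ))) =ᶠ[𝓝 (0 : ℝ)] fun s : ℝ => deriv h (s : ℂ) := by
    filter_upwards [hpre.mem_nhds hmem] with s hs
    exact (B13Contraction113.hasDerivAt_comp_ofReal (hd.differentiableAt (hU.mem_nhds hs)).hasDerivAt).deriv
  rw [hev.deriv_eq]
  have h2 := (B13Contraction113.hasDerivAt_comp_ofReal (t := (0 : ℝ)) (hd'.differentiableAt (hU.mem_nhds (by simpa using h0))).hasDerivAt).deriv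
  simpa using h2

/-! ## §1 Cauchy's estimate for the second derivative of the relative chart coordinate -/

/-- **THE SECOND `σ`-DERIVATIVE OF THE RELATIVE CHART COORDINATE IS `O(s²)`**: for a `U(n)`-valued `W` with `SmallField W a`, `512(d+1)(d+4)L²a ≤ 1`, and a direction with
`‖X(b)‖ ≤ s` (`s > 0`) on the bonds within `l¹`-distance `nbRad d L` of `c₋ = q`: `‖(d²∕dσ²)|₀ log(W̄(c)⁻¹·\overline{W e^{σX}}(c))‖ ≤ 4·s²∕rho0 d L²` — Cauchy's estimate on the
closed disc of radius `rho0∕(2s)`, inside the disc of holomorphy and of the bound `1∕2` (✓ `BlockAverageVaryDisc`). [folklore] -/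
theorem norm_deriv_deriv_relAvg_le [Nonempty n] {L : ℕ} (hL : 1 ≤ L) {W : Site d → Fin d → (Matrix n n ℂ)ˣ} (hW : IsUnitaryCfg W)
    {a : ℝ} (ha : 0 ≤ a) (hsmall : 512 * (d + 1) * (d + 4) * (L : ℝ) ^ 2 * a ≤ 1) (hWa : SmallField W a)
    {X : Site d → Fin d → Matrix n n ℂ} {q : Site d} {s : ℝ} (hs : 0 < s)
    (hX : ∀ (x : Site d) (μ : Fin d), l1 (x - q) ≤ nbRad d L → ‖X x μ‖ ≤ s) (κ : Fin d) :
    ‖deriv (deriv (relAvg L W X q κ)) 0‖ ≤ 4 * s ^ 2 / rho0 d L ^ 2 := by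
  have hρ := rho0_pos (d := d) hL
  have hd := differentiableOn_relAvg hL hW ha hsmall hWa hs hX κ
  have hM := norm_relAvg_le_of_mem_ball hL hW ha hsmall hWa hs hX κ
  have hr : 0 < rho0 d L / (2 * s) := by positivity
  have hsub : closedBall (0 : ℂ) (rho0 d L / (2 * s)) ⊆ ball (0 : ℂ) (rho0 d L / s) :=
    closedBall_subset_ball (by
      rw [div_lt_div_iff_of_pos_left hρ (by positivity) hs]
      linarith)
  -- Cauchy's estimate for the second derivative on the closed disc of radius `rho0∕(2s)` (Mathlib, `n = 2`)
  have h2 := Complex.norm_iteratedDeriv_le_of_forall_mem_sphere_norm_le 2 hr (hd.diffContOnCl_ball hsub)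
    fun z hz => hM z (hsub (sphere_subset_closedBall hz))
  rw [iteratedDeriv_succ, iteratedDeriv_one] at h2
  calc ‖deriv (deriv (relAvg L W X q κ)) 0‖ ≤ (2 : ℕ).factorial * (1 / 2) / (rho0 d L / (2 * s)) ^ 2 := h2
    _ = 4 * s ^ 2 / rho0 d L ^ 2 := by
        simp only [Nat.factorial]
        field_simp
        ring

/-! ## §2 The identifications: `coord` along a real ray is the relative chart coordinate; second Fréchet vs second ordinary derivatives -/

/-- **Along a real ray the chart coordinate of the average IS the relative chart coordinate of leaf-10**: for real `t`, the coarse torus bond `(y, κ)` and `ψ̃ = chartDir id ψ`,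
`coord L M W (t • ψ) y κ = relAvg L W ψ̃ (L·boxVec M y) κ t` (`chart_W(t•ψ) = W e^{tψ̃}`, `cavg = bavg` at `L·y`). [folklore] -/
theorem coord_smul_apply_eq_relAvg {L M : ℕ} [NeZero (L * M)] (W : Site d → Fin d → (Matrix n n ℂ)ˣ) (ψ : TDir d n (L * M))
    (t : ℝ) (y : Fin d → Fin M) (κ : Fin d) :
    coord (ContinuousLinearMap.id ℝ (Matrix n n ℂ)) L M W (t • ψ) y κ
      = relAvg L W (chartDir (ContinuousLinearMap.id ℝ (Matrix n n ℂ)) (L * M) ψ) ((L : ℤ) • boxVec M y) κ (t : ℂ) := by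
  rw [relAvg_ofReal, coord, chart_smul]
  rfl

section Calculus

variable {E G H : Type*} [NormedAddCommGroup E] [NormedSpace ℝ E] [NormedAddCommGroup G] [NormedSpace ℝ G]
  [NormedAddCommGroup H] [NormedSpace ℝ H]

/-- For a map of one real variable, `C²` at `0`: `D²c(0)[1,1] = c″(0)`. [folklore] -/
theorem fderiv_fderiv_one_one_eq_deriv_deriv {c : ℝ → G} (hc : ContDiffAt ℝ 2 c 0) :
    fderiv ℝ (fderiv ℝ c) 0 1 1 = deriv (deriv c) 0 := by
  have hD : DifferentiableAt ℝ (fderiv ℝ c) 0 :=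
    (hc.fderiv_right (m := 1) (by norm_num)).differentiableAt one_ne_zero
  have H : HasFDerivAt (fderiv ℝ c) (fderiv ℝ (fderiv ℝ c) 0) 0 := hD.hasFDerivAt
  have h1 : HasFDerivAt (fun t : ℝ => fderiv ℝ c t (1 : ℝ))
      ((fderiv ℝ c 0).comp (0 : ℝ →L[ℝ] ℝ) + (fderiv ℝ (fderiv ℝ c) 0).flip (1 : ℝ)) 0 :=
    H.clm_apply (hasFDerivAt_const (1 : ℝ) (0 : ℝ))
  have h2 : HasDerivAt (fun t : ℝ => fderiv ℝ c t (1 : ℝ)) (fderiv ℝ (fderiv ℝ c) 0 1 1) 0 := by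
    have h := h1.hasDerivAt
    simp only [add_apply, ContinuousLinearMap.comp_apply, zero_apply, map_zero, zero_add, ContinuousLinearMap.flip_apply] at h
    exact h
  have hfun : deriv c = fun t : ℝ => fderiv ℝ c t (1 : ℝ) := by
    funext t; exact fderiv_apply_one_eq_deriv.symm
  rw [hfun, h2.deriv]

/-- **Second Fréchet derivative along a direction vs second derivative along the ray, through a continuous linear read-out**: for `F : E → G` of class `C²` at `0`, `u ∈ E` and
`π : G →L[ℝ] H`, `π (D²F(0)[u, u]) = (d²∕dt²)|₀ π(F(t•u))`. [folklore] -/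
theorem apply_fderiv_fderiv_eq_deriv_deriv {F : E → G} (hF : ContDiffAt ℝ 2 F 0) (u : E) (π : G →L[ℝ] H) :
    π (fderiv ℝ (fderiv ℝ F) 0 u u) = deriv (deriv (fun t : ℝ => π (F (t • u)))) 0 := by
  -- the ray as a continuous linear map
  set ℓ : ℝ →L[ℝ] E := (1 : ℝ →L[ℝ] ℝ).smulRight u with hℓ
  have hℓ1 : ℓ 1 = u := by simp [hℓ]
  have hℓ0 : ℓ 0 = 0 := map_zero ℓ
  -- `π ∘ F` is `C²` at `0 = ℓ 0` and its second derivative is `π ∘ D²F`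
  have hπF : ContDiffAt ℝ 2 (fun x : E => π (F x)) 0 := π.contDiff.contDiffAt.comp 0 hF
  have hπD : fderiv ℝ (fderiv ℝ (fun x : E => π (F x))) 0 u u = π (fderiv ℝ (fderiv ℝ F) 0 u u) := by
    have h := fderiv_fderiv_comp_vec (f := fun y : G => π y) (Θ := F) (x := (0 : E)) π.contDiff.contDiffAt hF u u
    have hD1 : fderiv ℝ (fun y : G => π y) = fun _ => π := by funext y; exact π.fderiv
    have hD2 : fderiv ℝ (fderiv ℝ (fun y : G => π y)) (F 0) = 0 := by rw [hD1, fderiv_const_apply]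
    rw [hD2, hD1] at h
    simpa only [zero_apply, zero_add] using h
  -- along the ray
  have hc : ContDiffAt ℝ 2 (fun t : ℝ => π (F (t • u))) 0 := by
    have h : ContDiffAt ℝ 2 (fun x : E => π (F x)) (ℓ 0) := by rw [hℓ0]; exact hπF
    have h2 := h.comp 0 ℓ.contDiff.contDiffAt
    refine h2.congr_of_eventuallyEq (Filter.Eventually.of_forall fun t => ?_)
    simp [hℓ, Function.comp]
  have hray : fderiv ℝ (fderiv ℝ (fun t : ℝ => π (F (t • u)))) 0 1 1 = fderiv ℝ (fderiv ℝ (fun x : E => π (F x))) 0 u u := by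
    have h := fderiv_fderiv_comp_clm_vec (f := fun x : E => π (F x)) ℓ (x := (0 : ℝ)) (by rw [hℓ0]; exact hπF) 1 1
    rw [hℓ1, hℓ0] at h
    have e : (fun t : ℝ => π (F (t • u))) = fun t : ℝ => (fun x : E => π (F x)) (ℓ t) := by
      funext t; simp [hℓ]
    rw [e, h]
  rw [← hπD, ← hray, fderiv_fderiv_one_one_eq_deriv_deriv hc]

end Calculus

/-- The loops of (42) at a small-field base lie in the ball of the logarithm (✓ `norm_Wcx_sub_one_lt_one_of_smallField`). [folklore] -/
theorem ball_of_small512 [Nonempty n] {L : ℕ} (hL : 1 ≤ L) {W : Site d → Fin d → (Matrix n n ℂ)ˣ} (hW : IsUnitaryCfg W)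
    {a : ℝ} (ha : 0 ≤ a) (hsmall : 512 * (d + 1) * (d + 4) * (L : ℝ) ^ 2 * a ≤ 1) (hWa : SmallField W a) :
    ∀ (q : Site d) (κ : Fin d) (r : Fin d → Fin L), ‖((Wcx L W q κ (boxVec L r) : (Matrix n n ℂ)ˣ) : Matrix n n ℂ) - 1‖ < 1 :=
  fun q κ r => norm_Wcx_sub_one_lt_one_of_smallField L hL hW ha hsmall hWa q κ r

/-- **`(D²coord_W(0)[ψ, ψ]) y κ = (d²∕dσ²)|₀ relAvg L W ψ̃ (L·y) κ`**: the bond `(y, κ)` component of the second Fréchet derivative of the chart coordinates of the one-step average is the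
second complex derivative at `0` of leaf-10's relative chart coordinate along `ψ̃ = chartDir id ψ` (for `W` unitary small-field and `‖ψ̃‖ ≤ s`, `s > 0`, near the contours of the bond).
[folklore] -/
theorem fderiv_fderiv_coord_apply_eq [Nonempty n] {L M : ℕ} [NeZero (L * M)] (hL : 1 ≤ L) {W : Site d → Fin d → (Matrix n n ℂ)ˣ} (hW : IsUnitaryCfg W)
    {a : ℝ} (ha : 0 ≤ a) (hsmall : 512 * (d + 1) * (d + 4) * (L : ℝ) ^ 2 * a ≤ 1) (hWa : SmallField W a)
    (ψ : TDir d n (L * M)) (y : Fin d → Fin M) (κ : Fin d) {s : ℝ} (hs : 0 < s)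
    (hX : ∀ (x : Site d) (μ : Fin d), l1 (x - (L : ℤ) • boxVec M y) ≤ nbRad d L →
      ‖chartDir (ContinuousLinearMap.id ℝ (Matrix n n ℂ)) (L * M) ψ x μ‖ ≤ s) :
    (fderiv ℝ (fderiv ℝ (coord (ContinuousLinearMap.id ℝ (Matrix n n ℂ)) L M W)) 0 ψ ψ) y κ
      = deriv (deriv (relAvg L W (chartDir (ContinuousLinearMap.id ℝ (Matrix n n ℂ)) (L * M) ψ) ((L : ℤ) • boxVec M y) κ)) 0 := by
  have hcoord : ContDiffAt ℝ 2 (coord (ContinuousLinearMap.id ℝ (Matrix n n ℂ)) L M W) 0 :=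
    contDiffAt_coord (m := 2) (ContinuousLinearMap.id ℝ (Matrix n n ℂ)) L M W (ball_of_small512 hL hW ha hsmall hWa)
  -- the read-out of the bond `(y, κ)` as a continuous linear map
  set π : TDir d n M →L[ℝ] Matrix n n ℂ :=
    (ContinuousLinearMap.proj κ).comp (ContinuousLinearMap.proj (R := ℝ) (φ := fun _ : Fin d → Fin M => Fin d → Matrix n n ℂ) y) with hπ
  have hπapp : ∀ Φ : TDir d n M, π Φ = Φ y κ := fun Φ => rfl
  have h1 := apply_fderiv_fderiv_eq_deriv_deriv hcoord ψ π
  rw [hπapp] at h1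
  rw [h1]
  -- along the ray, `coord` is the relative chart coordinate at real points
  have hfun : (fun t : ℝ => π (coord (ContinuousLinearMap.id ℝ (Matrix n n ℂ)) L M W (t • ψ)))
      = fun t : ℝ => relAvg L W (chartDir (ContinuousLinearMap.id ℝ (Matrix n n ℂ)) (L * M) ψ) ((L : ℤ) • boxVec M y) κ (t : ℂ) := by
    funext t
    rw [hπapp, coord_smul_apply_eq_relAvg]
  rw [hfun]
  exact deriv_deriv_ofReal_eq isOpen_ball (differentiableOn_relAvg hL hW ha hsmall hWa hs hX κ)
    (mem_ball_self (div_pos (rho0_pos (d := d) hL) hs))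

/-! ## §3 The bond-by-bond bilinear-local bound -/

/-- **THE ONE-STEP KINEMATIC LETTER, bond by bond**: for a `U(n)`-valued `W` with `SmallField W a`, `512(d+1)(d+4)L²a ≤ 1`, every direction `ψ` of the fine torus and every coarse bond
`(y, κ)`: `‖(D²coord_W(0)[ψ, ψ]) y κ‖ ≤ (4∕rho0 d L²) · dirSq ψ̃ (box (nbRad d L) (L·y))` — the curvature of the chart coordinates of the one-step average at one coarse bond is bounded
by the squares of the direction on the `ℓ^∞` box of radius `nbRad d L = 2dL + 2L` about `c₋` (`sup² ≤ ℓ²` on the box, §1–§2). [folklore] -/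
theorem norm_fderiv_fderiv_coord_apply_le [Nonempty n] {L M : ℕ} [NeZero (L * M)] (hL : 1 ≤ L) {W : Site d → Fin d → (Matrix n n ℂ)ˣ} (hW : IsUnitaryCfg W)
    {a : ℝ} (ha : 0 ≤ a) (hsmall : 512 * (d + 1) * (d + 4) * (L : ℝ) ^ 2 * a ≤ 1) (hWa : SmallField W a)
    (ψ : TDir d n (L * M)) (y : Fin d → Fin M) (κ : Fin d) :
    ‖(fderiv ℝ (fderiv ℝ (coord (ContinuousLinearMap.id ℝ (Matrix n n ℂ)) L M W)) 0 ψ ψ) y κ‖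
      ≤ 4 / rho0 d L ^ 2 * dirSq (chartDir (ContinuousLinearMap.id ℝ (Matrix n n ℂ)) (L * M) ψ) (box (nbRad d L) ((L : ℤ) • boxVec M y)) := by
  set X : Site d → Fin d → Matrix n n ℂ := chartDir (ContinuousLinearMap.id ℝ (Matrix n n ℂ)) (L * M) ψ with hXdef
  set q : Site d := (L : ℤ) • boxVec M y with hq
  set S2 : ℝ := dirSq X (box (nbRad d L) q) with hS2
  have hS2nn : 0 ≤ S2 := by
    rw [hS2]; unfold dirSq; exact Finset.sum_nonneg fun _ _ => Finset.sum_nonneg fun _ _ => sq_nonneg _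
  have hρ := rho0_pos (d := d) hL
  -- for every `s > 0` dominating `X` near the contours, the Cauchy bound `4 s² ∕ rho0²`
  have key : ∀ s : ℝ, 0 < s → (∀ (x : Site d) (μ : Fin d), l1 (x - q) ≤ nbRad d L → ‖X x μ‖ ≤ s) →
      ‖(fderiv ℝ (fderiv ℝ (coord (ContinuousLinearMap.id ℝ (Matrix n n ℂ)) L M W)) 0 ψ ψ) y κ‖ ≤ 4 * s ^ 2 / rho0 d L ^ 2 := by
    intro s hs hXs
    rw [fderiv_fderiv_coord_apply_eq hL hW ha hsmall hWa ψ y κ hs hXs]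
    exact norm_deriv_deriv_relAvg_le hL hW ha hsmall hWa hs hXs κ
  have hsup : ∀ (x : Site d) (μ : Fin d), l1 (x - q) ≤ nbRad d L → ‖X x μ‖ ≤ Real.sqrt S2 := fun x μ hx => norm_le_sqrt_dirSq X hx μ
  rcases eq_or_lt_of_le hS2nn with hzero | hpos
  · -- degenerate box: the direction vanishes near the contours; every `s > 0` works
    have hle : ∀ s : ℝ, 0 < s → ‖(fderiv ℝ (fderiv ℝ (coord (ContinuousLinearMap.id ℝ (Matrix n n ℂ)) L M W)) 0 ψ ψ) y κ‖ ≤ 4 * s ^ 2 / rho0 d L ^ 2 :=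
      fun s hs => key s hs fun x μ hx => (hsup x μ hx).trans (by rw [← hzero, Real.sqrt_zero]; exact hs.le)
    have h0 : ‖(fderiv ℝ (fderiv ℝ (coord (ContinuousLinearMap.id ℝ (Matrix n n ℂ)) L M W)) 0 ψ ψ) y κ‖ ≤ 0 := by
      refine le_of_forall_pos_le_add fun ε hε => ?_
      -- choose `s` with `4 s² ∕ rho0² ≤ ε`
      obtain ⟨s, hs0, hsε⟩ : ∃ s : ℝ, 0 < s ∧ 4 * s ^ 2 / rho0 d L ^ 2 ≤ ε := by
        refine ⟨min 1 (ε * rho0 d L ^ 2 / 4), lt_min one_pos (by positivity), ?_⟩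
        have hm1 : min 1 (ε * rho0 d L ^ 2 / 4) ≤ 1 := min_le_left _ _
        have hm2 : min 1 (ε * rho0 d L ^ 2 / 4) ≤ ε * rho0 d L ^ 2 / 4 := min_le_right _ _
        have hm0 : 0 ≤ min 1 (ε * rho0 d L ^ 2 / 4) := (lt_min one_pos (by positivity)).le
        have hsq : min 1 (ε * rho0 d L ^ 2 / 4) ^ 2 ≤ ε * rho0 d L ^ 2 / 4 := by
          calc min 1 (ε * rho0 d L ^ 2 / 4) ^ 2 = min 1 (ε * rho0 d L ^ 2 / 4) * min 1 (ε * rho0 d L ^ 2 / 4) := sq _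
            _ ≤ 1 * (ε * rho0 d L ^ 2 / 4) := mul_le_mul hm1 hm2 hm0 zero_le_one
            _ = ε * rho0 d L ^ 2 / 4 := one_mul _
        rw [div_le_iff₀ (by positivity)]
        nlinarith [hρ]
      linarith [hle s hs0]
    exact h0.trans (by rw [← hzero, mul_zero])
  · have h := key (Real.sqrt S2) (Real.sqrt_pos.mpr hpos) hsup
    calc _ ≤ 4 * Real.sqrt S2 ^ 2 / rho0 d L ^ 2 := h
      _ = 4 / rho0 d L ^ 2 * S2 := by rw [Real.sq_sqrt hS2nn]; ring

/-! ## §4 The `ℓ¹∕ℓ²` dress over one period -/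

omit [Fintype n] [DecidableEq n] in
/-- The chart direction of a torus parameter is periodic. [folklore] -/
theorem isPeriodicDir_chartDir (N : ℕ) [NeZero N] (ψ : TDir d n N) :
    IsPeriodicDir (chartDir (ContinuousLinearMap.id ℝ (Matrix n n ℂ)) N ψ) (N : ℤ) := by
  intro x i μ
  exact chartDir_add_smul (ContinuousLinearMap.id ℝ (Matrix n n ℂ)) N ψ x (e i) μ

/-- **THE ONE-STEP KINEMATIC LETTER, `ℓ¹∕ℓ²` DRESS OVER ONE PERIOD**: for a `U(n)`-valued `W` with `SmallField W a`, `512(d+1)(d+4)L²a ≤ 1`, `L, M ≥ 1`, and every direction `ψ` of the fine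
torus `[0, LM)^d`: `Σ_{y ∈ [0,M)^d} Σ_κ ‖(D²coord_W(0)[ψ,ψ]) y κ‖ ≤ (4∕rho0 d L²)·d·(2·nbRad d L + 1)^d · dirSq ψ̃ (periodBox (L·M))` — the `ℓ¹` norm of the curvature of the chart
coordinates of the one-step average on the coarse torus against the UNWEIGHTED `ℓ²` mass of the direction on the fine torus; constant in `d, L` only (no volume, no level).
[folklore] -/
theorem sum_norm_fderiv_fderiv_coord_le [Nonempty n] {L M : ℕ} [NeZero (L * M)] (hL : 1 ≤ L) (hM : 1 ≤ M) {W : Site d → Fin d → (Matrix n n ℂ)ˣ}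
    (hW : IsUnitaryCfg W) {a : ℝ} (ha : 0 ≤ a) (hsmall : 512 * (d + 1) * (d + 4) * (L : ℝ) ^ 2 * a ≤ 1) (hWa : SmallField W a)
    (ψ : TDir d n (L * M)) :
    ∑ y : Fin d → Fin M, ∑ κ : Fin d, ‖(fderiv ℝ (fderiv ℝ (coord (ContinuousLinearMap.id ℝ (Matrix n n ℂ)) L M W)) 0 ψ ψ) y κ‖
      ≤ 4 / rho0 d L ^ 2 * (d * (2 * nbRad d L + 1) ^ d) * dirSq (chartDir (ContinuousLinearMap.id ℝ (Matrix n n ℂ)) (L * M) ψ) (periodBox (L * M)) := by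
  set X : Site d → Fin d → Matrix n n ℂ := chartDir (ContinuousLinearMap.id ℝ (Matrix n n ℂ)) (L * M) ψ with hXdef
  have hXp : IsPeriodicDir X ((L : ℤ) * M) := by
    have h := isPeriodicDir_chartDir (L * M) ψ
    rwa [Nat.cast_mul] at h
  have hC : 0 ≤ 4 / rho0 d L ^ 2 := by positivity
  -- bond by bond
  have hbond : ∑ y : Fin d → Fin M, ∑ κ : Fin d, ‖(fderiv ℝ (fderiv ℝ (coord (ContinuousLinearMap.id ℝ (Matrix n n ℂ)) L M W)) 0 ψ ψ) y κ‖
      ≤ ∑ y : Fin d → Fin M, ∑ _κ : Fin d, 4 / rho0 d L ^ 2 * dirSq X (box (nbRad d L) ((L : ℤ) • boxVec M y)) :=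
    Finset.sum_le_sum fun y _ => Finset.sum_le_sum fun κ _ => norm_fderiv_fderiv_coord_apply_le hL hW ha hsmall hWa ψ y κ
  -- the torus multiplicity of the contour neighbourhoods
  have hper : ∑ y ∈ periodBox M, dirSq X (box (nbRad d L) ((L : ℤ) • y)) ≤ (2 * nbRad d L + 1) ^ d * dirSq X (periodBox (L * M)) := by
    unfold dirSq
    refine sum_periodBox_box_le L M hL hM (nbRad d L) (fun _ => Finset.sum_nonneg fun _ _ => sq_nonneg _) fun x κ => ?_
    rw [natCast_mul_period]
    exact Finset.sum_congr rfl fun μ _ => by rw [hXp x κ μ]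
  have hsumbox : ∑ y : Fin d → Fin M, dirSq X (box (nbRad d L) ((L : ℤ) • boxVec M y)) = ∑ y ∈ periodBox M, dirSq X (box (nbRad d L) ((L : ℤ) • y)) := by
    rw [periodBox, Finset.sum_image fun r _ r' _ h => T4TermwiseTorus.boxVec_injective M h]
  calc ∑ y : Fin d → Fin M, ∑ κ : Fin d, ‖(fderiv ℝ (fderiv ℝ (coord (ContinuousLinearMap.id ℝ (Matrix n n ℂ)) L M W)) 0 ψ ψ) y κ‖
      ≤ ∑ y : Fin d → Fin M, ∑ _κ : Fin d, 4 / rho0 d L ^ 2 * dirSq X (box (nbRad d L) ((L : ℤ) • boxVec M y)) := hbond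
    _ = 4 / rho0 d L ^ 2 * d * ∑ y : Fin d → Fin M, dirSq X (box (nbRad d L) ((L : ℤ) • boxVec M y)) := by
        rw [Finset.mul_sum]
        refine Finset.sum_congr rfl fun y _ => ?_
        rw [Finset.sum_const, Finset.card_univ, Fintype.card_fin, nsmul_eq_mul]
        ring
    _ ≤ 4 / rho0 d L ^ 2 * d * ((2 * nbRad d L + 1) ^ d * dirSq X (periodBox (L * M))) := by
        rw [hsumbox]
        exact mul_le_mul_of_nonneg_left hper (by positivity)
    _ = 4 / rho0 d L ^ 2 * (d * (2 * nbRad d L + 1) ^ d) * dirSq X (periodBox (L * M)) := by ring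

/-- **The same under row NE3-R2's multi-level class hypotheses** (`W` unitary, `SmallField W x`, `0 ≤ x`, `LevelSmall d L j x` — the form in which ✓ `NE7ConstraintSecondDerivativeRecursion`
runs down the tower; `LevelSmall ⇒ 512(d+1)(d+4)L²x ≤ 1` by ✓ `smallness_of_twoLevelSmall` ∕ `small512_of_liftSmall`). [folklore] -/
theorem sum_norm_fderiv_fderiv_coord_le_of_levelSmall [Nonempty n] {L M : ℕ} [NeZero (L * M)] (hL : 1 ≤ L) (hM : 1 ≤ M) (j : ℕ)
    {W : Site d → Fin d → (Matrix n n ℂ)ˣ} {x : ℝ} (hW : IsUnitaryCfg W) (hx : 0 ≤ x) (hs : LevelSmall d L j x) (hWx : SmallField W x)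
    (ψ : TDir d n (L * M)) :
    ∑ y : Fin d → Fin M, ∑ κ : Fin d, ‖(fderiv ℝ (fderiv ℝ (coord (ContinuousLinearMap.id ℝ (Matrix n n ℂ)) L M W)) 0 ψ ψ) y κ‖
      ≤ 4 / rho0 d L ^ 2 * (d * (2 * nbRad d L + 1) ^ d) * dirSq (chartDir (ContinuousLinearMap.id ℝ (Matrix n n ℂ)) (L * M) ψ) (periodBox (L * M)) := by
  obtain ⟨hlift, -, -, -⟩ := smallness_of_twoLevelSmall (d := d) hL hx hs.two
  exact sum_norm_fderiv_fderiv_coord_le hL hM hW hx (small512_of_liftSmall hL hx hlift) hWx ψ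

end

end Summit.QuantumFields.BalabanUV.T4Continuum.NE7OneStepConstraintCurvature
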